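import Mathlib

/-!
# Counting `Circle`-valued characters trivial on a finite-index subgroup: `[G : N]` of them

The `Circle`-valued form of `T5CharacterCount` (the cell's unitary characters are often written
`G →* Circle`, e.g. in `T5ContinuousDescent` / `T5ContinuousCharacterExtension`): for a commutative
group `G` and a subgroup `N` of finite index,

* `card_monoidHom_circle`: a finite commutative group has as many `Circle`-valued characters as
  elements (`toUnits : Circle ≃* Circleˣ` + Mathlib's duality, `Circle` having enough roots of unity);
* `card_ker_restrictHom_circle` / `ncard_setOf_eq_one_on_circle`: `#{χ : G →* Circle ∣ χ|_N = 1} = [G : N]`;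
* `ncard_setOf_eq_one_on_and_not_circle`: for `N ≤ N'`, `[G : N] − [G : N']` characters are trivial
  on `N` but not on `N'`.

Declaration per README §8(d): «uses an L-value-free non-vanishing device: NO».
-/

namespace Summit.Ventures.HodgeRepro2.T5CircleCharacterCount

/-- A finite commutative group has exactly `|G|` characters with values in the circle. -/
theorem card_monoidHom_circle (G : Type*) [CommGroup G] [Finite G] :
    Nat.card (G →* Circle) = Nat.card G := by
  rw [Nat.card_congr (MulEquiv.monoidHomCongrRight (toUnits : Circle ≃* Circleˣ)).toEquiv]
  exact CommGroup.card_monoidHom_of_hasEnoughRootsOfUnity G Circle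

variable {G : Type*} [CommGroup G]

/-- The characters trivial on `N` are the kernel of the restriction map to `N`. -/
theorem mem_ker_restrictHom_iff (N : Subgroup G) (χ : G →* Circle) :
    χ ∈ (MonoidHom.restrictHom N Circle).ker ↔ ∀ y ∈ N, χ y = 1 := by
  rw [MonoidHom.mem_ker, MonoidHom.restrictHom_apply, MonoidHom.restrict_eq_one_iff]

/-- `#{χ : G →* Circle ∣ χ|_N = 1} = [G : N]` for `N` of finite index. -/
theorem card_ker_restrictHom_circle (N : Subgroup G) (hN : N.index ≠ 0) :
    Nat.card (MonoidHom.restrictHom N Circle).ker = N.index := by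
  haveI : Finite (G ⧸ N) := Subgroup.index_ne_zero_iff_finite.mp hN
  rw [Nat.card_congr (MonoidHom.restrictHomKerEquiv Circle N).toEquiv,
    card_monoidHom_circle (G ⧸ N), Subgroup.index_eq_card]

/-- The set of characters trivial on `N`, as a set. -/
theorem setOf_eq_one_on_eq (N : Subgroup G) :
    {χ : G →* Circle | ∀ y ∈ N, χ y = 1} =
      ((MonoidHom.restrictHom N Circle).ker : Set (G →* Circle)) := by
  ext χ
  exact (mem_ker_restrictHom_iff N χ).symm

/-- `ncard` form of the count. -/
theorem ncard_setOf_eq_one_on_circle (N : Subgroup G) (hN : N.index ≠ 0) :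
    {χ : G →* Circle | ∀ y ∈ N, χ y = 1}.ncard = N.index := by
  rw [setOf_eq_one_on_eq, ← Nat.card_coe_set_eq]
  exact card_ker_restrictHom_circle N hN

/-- The set of characters trivial on a finite-index subgroup is finite. -/
theorem finite_setOf_eq_one_on_circle (N : Subgroup G) (hN : N.index ≠ 0) :
    {χ : G →* Circle | ∀ y ∈ N, χ y = 1}.Finite := by
  rw [← Set.finite_coe_iff]
  apply Nat.finite_of_card_ne_zero
  rw [Nat.card_coe_set_eq, ncard_setOf_eq_one_on_circle N hN]
  exact hN

/-- EXACT LEVEL: for `N ≤ N'` of finite index, `[G : N] − [G : N']` circle-valued characters are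
trivial on `N` but not on `N'`. -/
theorem ncard_setOf_eq_one_on_and_not_circle {N N' : Subgroup G} (h : N ≤ N') (hN : N.index ≠ 0) :
    {χ : G →* Circle | (∀ y ∈ N, χ y = 1) ∧ ¬ ∀ y ∈ N', χ y = 1}.ncard =
      N.index - N'.index := by
  have hN' : N'.index ≠ 0 := by
    intro h0
    exact hN (zero_dvd_iff.mp (h0 ▸ Subgroup.index_dvd_of_le h))
  have hsub : {χ : G →* Circle | ∀ y ∈ N', χ y = 1} ⊆ {χ : G →* Circle | ∀ y ∈ N, χ y = 1} :=
    fun χ hχ y hy => hχ y (h hy)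
  have heq : {χ : G →* Circle | (∀ y ∈ N, χ y = 1) ∧ ¬ ∀ y ∈ N', χ y = 1} =
      {χ : G →* Circle | ∀ y ∈ N, χ y = 1} \ {χ : G →* Circle | ∀ y ∈ N', χ y = 1} := by
    ext χ
    simp only [Set.mem_setOf_eq, Set.mem_sdiff]
  rw [heq, Set.ncard_sdiff hsub (finite_setOf_eq_one_on_circle N' hN'),
    ncard_setOf_eq_one_on_circle N hN, ncard_setOf_eq_one_on_circle N' hN']

end Summit.Ventures.HodgeRepro2.T5CircleCharacterCount
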